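import Literature.RingTheory.LocalCohomology.CechTwisted
import Mathlib.RingTheory.Ideal.Quotient.Operations
import Mathlib.RingTheory.UniqueFactorizationDomain.Basic
import Mathlib.Order.OrderIsoNat
import HarnessLib

/-!
# Formal sections of a line bundle on the punctured spectrum of a hypersurface

Topic `Literature/RingTheory/LocalCohomology`, sequel of `CechTwisted.lean`. This is the Čech
rendering of the existence half of SGA 2 XI 3.13 (ii) / IX §2 for a hypersurface `g = 0` in a
ring `S`: the thickenings `S/(g^k)` (`Thick g k`) with their reductions (`thickRed`) and the
multiplications by `g^e` (`thickMul`, exact / injective / square-zero as needed); for a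
compatible family of unit cocycles `u_L` on the `S/(g^L)` (`IsCompatible`; constructed from `u₁`
by iterated lifting, `liftFam`/`uFam`, when `H³_𝔪(S/(g)) = 0`) the modules of sections
`Γ_L = TZ0 (u L)`, the images `secIm u L L'`, the obstruction modules `Fobs u L ⊆ E = TH2 (u 1)`
(increasing in `L`, `Fobs_mono`), and the **uniform Mittag-Leffler theorem** `secIm_stable`
(`E` Noetherian ⇒ the images `im(Γ_{L+c} → Γ_L)` are stationary in `c`, uniformly in `L`);
the comparison `twistToIdeal` of the twisted complex of `S/(g)` with the Čech complex of an ideal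
`J` invertible on the cover (`u(i,j) = a_j / a_i`, `coverCocycle`), giving
`isNoetherian_TH2_of_cover`; the limit module `Nlim u n` of the stable sections with its
projections onto the stable images (`exists_mem_Nlim_apply_eq`), the kernel `gN` of the first
projection (`exists_eq_smul_of_apply_one_eq_zero`), `g`-adic separatedness, torsion-freeness over
a factorial `S` (`Nlim_torsionFree`), the finite-colength bound `pow_smul_TZ0_one_le_Istab`, and
the comparison map `compIdeal : N → J` with the properties needed by the algebraisation endgame
(`Literature/RingTheory/RegularLocalRing/SamuelEndgame.lean`).

Everything is proved; no named facts.

## References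

* [Grothendieck1968SGA2] A. Grothendieck, SGA 2, Exp. IX §1–2 and Exp. XI 3.13, 3.16
  (arXiv:math/0511279, pp. 55–58, 70–72).
* [Eisenbud2005] D. Eisenbud, *The Geometry of Syzygies*, GTM 229, Appendix 1, Thm. A1.3.
-/

noncomputable section

open CategoryTheory AlgebraicTopology

universe u

namespace Literature.RingTheory.LocalCohomology

variable {R : Type u} [CommRing R] {s : ℕ} (y : Fin s → R) (M : Type u) [AddCommGroup M]
  [Module R M]

/-! ## The tower of thickenings `S/(g^k)` -/

section Tower

variable {S : Type u} [CommRing S] (g : S)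

/-- The `k`-th infinitesimal neighbourhood `S/(g^k)` of the hypersurface `g = 0`. [folklore] -/
abbrev Thick (k : ℕ) : Type u := S ⧸ Ideal.span {g ^ k}

/-- `(g^{k'}) ⊆ (g^k)` for `k ≤ k'`. [folklore] -/
theorem span_pow_le_span_pow {k k' : ℕ} (h : k ≤ k') :
    Ideal.span {g ^ k'} ≤ Ideal.span ({g ^ k} : Set S) :=
  Ideal.span_singleton_le_span_singleton.mpr (pow_dvd_pow g h)

/-- The reduction `S/(g^{k'}) → S/(g^k)`, `k ≤ k'`. [folklore] -/
def thickRed (k k' : ℕ) (h : k ≤ k') : Thick g k' →ₐ[S] Thick g k :=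
  Ideal.Quotient.factorₐ S (span_pow_le_span_pow g h)

/-- `thickRed` on representatives. [folklore] -/
@[simp]
theorem thickRed_mk {k k' : ℕ} (h : k ≤ k') (x : S) :
    thickRed g k k' h (Ideal.Quotient.mk _ x) = Ideal.Quotient.mk _ x := rfl

/-- The reductions are surjective. [folklore] -/
theorem thickRed_surjective {k k' : ℕ} (h : k ≤ k') : Function.Surjective (thickRed g k k' h) :=
  Ideal.Quotient.factor_surjective (span_pow_le_span_pow g h)

/-- Transitivity of the reductions. [folklore] -/
theorem thickRed_comp {k k' k'' : ℕ} (h : k ≤ k') (h' : k' ≤ k'') :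
    (thickRed g k k' h).comp (thickRed g k' k'' h') = thickRed g k k'' (h.trans h') :=
  Ideal.Quotient.factorₐ_comp S _ _

/-- Transitivity of the reductions, pointwise. [folklore] -/
theorem thickRed_thickRed {k k' k'' : ℕ} (h : k ≤ k') (h' : k' ≤ k'') (x : Thick g k'') :
    thickRed g k k' h (thickRed g k' k'' h' x) = thickRed g k k'' (h.trans h') x := by
  rw [← AlgHom.comp_apply, thickRed_comp]

/-- Multiplication by `g^e`: `S/(g^j) → S/(g^i)`, `x ↦ g^e x` (`i ≤ j + e`). [folklore] -/
def thickMul (e j i : ℕ) (h : i ≤ j + e) : Thick g j →ₗ[S] Thick g i :=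
  Submodule.liftQ (Ideal.span {g ^ j})
    ((Submodule.mkQ (Ideal.span {g ^ i})) ∘ₗ LinearMap.mulLeft S (g ^ e)) (by
      intro x hx
      rw [LinearMap.mem_ker, LinearMap.comp_apply, Submodule.mkQ_apply, LinearMap.mulLeft_apply,
        Submodule.Quotient.mk_eq_zero]
      obtain ⟨a, rfl⟩ := Ideal.mem_span_singleton'.mp hx
      obtain ⟨d, hd⟩ := Nat.exists_eq_add_of_le h
      refine Ideal.mem_span_singleton'.mpr ⟨a * g ^ d, ?_⟩
      calc a * g ^ d * g ^ i = a * g ^ (i + d) := by ring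
        _ = a * g ^ (j + e) := by rw [hd]
        _ = g ^ e * (a * g ^ j) := by ring)

/-- `thickMul` on representatives. [folklore] -/
@[simp]
theorem thickMul_mk {e j i : ℕ} (h : i ≤ j + e) (x : S) :
    thickMul g e j i h (Ideal.Quotient.mk _ x) = Ideal.Quotient.mk _ (g ^ e * x) := rfl

/-- Reduce after multiplying. [folklore] -/
theorem thickRed_thickMul {e j i k : ℕ} (h : i ≤ j + e) (hk : k ≤ i) (x : Thick g j) :
    thickRed g k i hk (thickMul g e j i h x) = thickMul g e j k (hk.trans h) x := by
  obtain ⟨x, rfl⟩ := Ideal.Quotient.mk_surjective x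
  rfl

/-- Multiply after reducing. [folklore] -/
theorem thickMul_thickRed {e j j' i : ℕ} (hjj' : j ≤ j') (h : i ≤ j + e) (x : Thick g j') :
    thickMul g e j i h (thickRed g j j' hjj' x) = thickMul g e j' i (h.trans (by omega)) x := by
  obtain ⟨x, rfl⟩ := Ideal.Quotient.mk_surjective x
  rfl

/-- Iterated multiplication. [folklore] -/
theorem thickMul_thickMul {e e' j i l : ℕ} (h : i ≤ j + e) (h' : l ≤ i + e') (x : Thick g j) :
    thickMul g e' i l h' (thickMul g e j i h x) = thickMul g (e + e') j l (by omega) x := by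
  obtain ⟨x, rfl⟩ := Ideal.Quotient.mk_surjective x
  simp only [thickMul_mk]
  congr 1
  ring

/-- Semilinearity of the multiplication maps for the reductions. [folklore] -/
theorem thickMul_semilinear {e j i : ℕ} (h : i ≤ j + e) (hji : j ≤ i) (a : Thick g i)
    (x : Thick g j) : thickMul g e j i h (thickRed g j i hji a * x) = a * thickMul g e j i h x := by
  obtain ⟨a, rfl⟩ := Ideal.Quotient.mk_surjective a
  obtain ⟨x, rfl⟩ := Ideal.Quotient.mk_surjective x
  rw [thickRed_mk, ← map_mul, thickMul_mk, thickMul_mk, ← map_mul]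
  congr 1
  ring

/-- Exactness of `S/(g^{j}) →(g^e) S/(g^i) → S/(g^e)`. [folklore] -/
theorem exact_thickMul_thickRed {e j i : ℕ} (h : i ≤ j + e) (hei : e ≤ i) :
    Function.Exact (thickMul g e j i h) (thickRed g e i hei).toLinearMap := by
  intro a
  obtain ⟨a, rfl⟩ := Ideal.Quotient.mk_surjective a
  rw [AlgHom.toLinearMap_apply, thickRed_mk, Ideal.Quotient.eq_zero_iff_mem, Set.mem_range]
  constructor
  · intro ha
    obtain ⟨b, rfl⟩ := Ideal.mem_span_singleton'.mp ha
    exact ⟨Ideal.Quotient.mk _ b, by rw [thickMul_mk, mul_comm]⟩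
  · rintro ⟨x, hx⟩
    obtain ⟨x, rfl⟩ := Ideal.Quotient.mk_surjective x
    rw [thickMul_mk, Ideal.Quotient.eq] at hx
    obtain ⟨c, hc⟩ := Ideal.mem_span_singleton'.mp hx
    obtain ⟨d, rfl⟩ := Nat.exists_eq_add_of_le hei
    refine Ideal.mem_span_singleton'.mpr ⟨x - c * g ^ d, ?_⟩
    rw [pow_add] at hc
    linear_combination -hc

/-- `g^e · : S/(g^j) → S/(g^{j+e})` is injective when `g` is a non-zero-divisor. [folklore] -/
theorem thickMul_injective (hg : g ∈ nonZeroDivisors S) {e j i : ℕ} (hi : i = j + e) :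
    Function.Injective (thickMul g e j i hi.le) := by
  subst hi
  rw [injective_iff_map_eq_zero]
  intro x hx
  obtain ⟨x, rfl⟩ := Ideal.Quotient.mk_surjective x
  rw [thickMul_mk, Ideal.Quotient.eq_zero_iff_mem] at hx
  obtain ⟨c, hc⟩ := Ideal.mem_span_singleton'.mp hx
  rw [Ideal.Quotient.eq_zero_iff_mem]
  refine Ideal.mem_span_singleton'.mpr ⟨c, ?_⟩
  have : g ^ e * (c * g ^ j - x) = 0 := by rw [mul_sub, ← hc]; ring
  have hge : g ^ e ∈ nonZeroDivisors S := pow_mem hg e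
  exact sub_eq_zero.mp ((mul_left_mem_nonZeroDivisors_eq_zero_iff hge).mp this |> fun h => by
    linear_combination h)

/-- Products in the image of `g^e ·` vanish in `S/(g^i)` when `2e ≥ i`. [folklore] -/
theorem thickMul_mul_thickMul {e j i : ℕ} (h : i ≤ j + e) (h2 : i ≤ 2 * e) (x x' : Thick g j) :
    thickMul g e j i h x * thickMul g e j i h x' = 0 := by
  obtain ⟨x, rfl⟩ := Ideal.Quotient.mk_surjective x
  obtain ⟨x', rfl⟩ := Ideal.Quotient.mk_surjective x'
  rw [thickMul_mk, thickMul_mk, ← map_mul, Ideal.Quotient.eq_zero_iff_mem]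
  obtain ⟨d, hd⟩ := Nat.exists_eq_add_of_le h2
  refine Ideal.mem_span_singleton'.mpr ⟨x * x' * g ^ d, ?_⟩
  rw [show g ^ e * x * (g ^ e * x') = g ^ (2 * e) * (x * x') by ring, hd, pow_add]
  ring

end Tower

/-! ## Sections of the formal line bundle: uniform Mittag-Leffler -/

section MittagLeffler

variable {S : Type u} [CommRing S] {g : S} {s : ℕ} {y : Fin s → S}

/-- `g^e · : S/(g^j) → S/(g^i)` is zero when `i ≤ e`. [folklore] -/
theorem thickMul_eq_zero_of_le {e j i : ℕ} (h : i ≤ j + e) (hie : i ≤ e) (x : Thick g j) :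
    thickMul g e j i h x = 0 := by
  obtain ⟨x, rfl⟩ := Ideal.Quotient.mk_surjective x
  rw [thickMul_mk, Ideal.Quotient.eq_zero_iff_mem]
  obtain ⟨d, rfl⟩ := Nat.exists_eq_add_of_le hie
  exact Ideal.mem_span_singleton'.mpr ⟨g ^ d * x, by rw [pow_add]; ring⟩

variable (u : ∀ L : ℕ, CechObj y (Thick g L) 1)

/-- A *compatible family of twists* `u` on the thickenings `S/(g^L)`: each `u_{L'}` reduces to
`u_L`. [folklore] -/
def IsCompatible (u : ∀ L : ℕ, CechObj y (Thick g L) 1) : Prop :=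
  ∀ (L L' : ℕ) (h : L ≤ L'), cechObjMap y (thickRed g L L' h).toLinearMap 1 (u L') = u L

variable {u}

/-- Reductions map sections to sections. [folklore] -/
theorem dT_cechObjMap_thickRed (hc : IsCompatible u) {L L' : ℕ} (h : L ≤ L')
    (σ : CechObj y (Thick g L') 0) (hσ : dT (u L') 0 σ = 0) :
    dT (u L) 0 (cechObjMap y (thickRed g L L' h).toLinearMap 0 σ) = 0 := by
  rw [← hc L L' h, ← cechObjMap_dT, hσ, map_zero]

/-- Multiplications `g^e ·` map sections to sections. [folklore] -/
theorem dT_cechObjMap_thickMul (hc : IsCompatible u) {e L i : ℕ} (h : i ≤ L + e) (hLi : L ≤ i)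
    (σ : CechObj y (Thick g L) 0) (hσ : dT (u L) 0 σ = 0) :
    dT (u i) 0 (cechObjMap y (thickMul g e L i h) 0 σ) = 0 := by
  rw [← cechObjMap_dT_semilinear (thickRed g L i hLi) (thickMul g e L i h)
    (fun a x => thickMul_semilinear g h hLi a x), hc L i hLi, hσ, map_zero]

variable (u) in
/-- The image of the level-`L'` sections in the level-`L` sections. [folklore] -/
def secIm (L L' : ℕ) (h : L ≤ L') : Submodule S (CechObj y (Thick g L) 0) :=
  (TZ0 (u L')).map (cechObjMap y (thickRed g L L' h).toLinearMap 0)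

/-- Membership in the image of sections. [folklore] -/
theorem mem_secIm_iff {L L' : ℕ} (h : L ≤ L') (σ : CechObj y (Thick g L) 0) :
    σ ∈ secIm u L L' h ↔ ∃ τ : CechObj y (Thick g L') 0, dT (u L') 0 τ = 0 ∧
      cechObjMap y (thickRed g L L' h).toLinearMap 0 τ = σ := by
  simp [secIm, Submodule.mem_map, LinearMap.mem_ker]

/-- The images decrease. [folklore] -/
theorem secIm_anti (hc : IsCompatible u) {L L' L'' : ℕ} (h : L ≤ L') (h' : L' ≤ L'') :
    secIm u L L'' (h.trans h') ≤ secIm u L L' h := by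
  intro σ hσ
  rw [mem_secIm_iff] at hσ ⊢
  obtain ⟨τ, hτ, rfl⟩ := hσ
  refine ⟨cechObjMap y (thickRed g L' L'' h').toLinearMap 0 τ, dT_cechObjMap_thickRed hc h' τ hτ, ?_⟩
  rw [← LinearMap.comp_apply, ← cechObjMap_comp]
  congr 2
  apply LinearMap.ext
  intro x
  exact thickRed_thickRed g h h' x

variable (u) in
/-- The obstruction classes at level `L` (for lifting sections from `S/(g^L)` to `S/(g^{L+1})`),
a submodule of `E = H²(S/(g), u₁)`. [folklore] -/
def Fobs (L : ℕ) : Submodule S (TH2 (u 1)) :=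
  obsSubmodule (thickRed g L (L + 1) (by omega)) (thickMul g L 1 (L + 1) (by omega)) (u (L + 1)) (u 1)

/-- The obstruction classes increase with the level (`γ = g^e ·` preserves them). [folklore] -/
theorem Fobs_mono (hc : IsCompatible u) (L e : ℕ) : Fobs u L ≤ Fobs u (L + e) := by
  rintro x ⟨σ, hσ, hobs⟩
  rw [hc L (L + 1) (by omega)] at hσ
  refine ⟨cechObjMap y (thickMul g e L (L + e) le_rfl) 0 σ, ?_, ?_⟩
  · rw [hc (L + e) (L + e + 1) (by omega)]
    exact dT_cechObjMap_thickMul hc le_rfl (by omega) σ hσ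
  · refine IsObs.map_gamma (π₂ := thickRed g (L + e) (L + e + 1) (by omega))
      (m₂ := thickMul g (L + e) 1 (L + e + 1) (by omega)) (u₂ := u (L + e + 1))
      (θ := thickRed g (L + 1) (L + e + 1) (by omega))
      (γ' := thickMul g e L (L + e) le_rfl) (γ := thickMul g e (L + 1) (L + e + 1) (by omega))
      ?_ ?_ ?_ (hc _ _ _) hobs
    · apply LinearMap.ext
      intro x
      obtain ⟨x, rfl⟩ := Ideal.Quotient.mk_surjective x
      rfl
    · apply LinearMap.ext
      intro x
      rw [LinearMap.comp_apply, thickMul_thickMul]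
    · intro a x
      exact thickMul_semilinear g _ _ a x

omit [CommRing S] in
/-- `Č^n` of the zero map is zero. [folklore] -/
theorem cechObjMap_zero' {R' : Type u} [CommRing R'] {s' : ℕ} (y' : Fin s' → R') {N P : Type u}
    [AddCommGroup N] [Module R' N] [AddCommGroup P] [Module R' P] (n : ℕ) :
    cechObjMap y' (0 : N →ₗ[R'] P) n = 0 := by
  apply LinearMap.ext
  intro c
  funext t
  rw [cechObjMap_apply, LinearMap.zero_apply, Pi.zero_apply]
  unfold locMap
  rw [LinearMap.map_zero, LinearMap.zero_apply]

/-- **Key step of the uniform Mittag-Leffler property**: once the obstruction modules have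
stabilised (`F_{L+c} = F_c`), every level-`L` section that lifts `c` levels lifts `c + 1` levels.
[cite: Grothendieck1968SGA2, Exp. IX, proof of Prop. 1.5 / Exp. XI 3.16] -/
theorem secIm_le_secIm_succ (hc : IsCompatible u) (hcoc : ∀ L, IsMulCocycle (u L))
    (hg : g ∈ nonZeroDivisors S) {L c : ℕ} (hc1 : 1 ≤ c) (hF : Fobs u (L + c) = Fobs u c) :
    secIm u L (L + c) (by omega) ≤ secIm u L (L + c + 1) (by omega) := by
  intro σ hσ
  rw [mem_secIm_iff] at hσ ⊢
  obtain ⟨τ, hτ, rfl⟩ := hσ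
  -- the obstruction class of `τ` at level `L + c`
  have hex : Function.Exact (thickMul g (L + c) 1 (L + c + 1) (by omega))
      (thickRed g (L + c) (L + c + 1) (by omega)).toLinearMap :=
    exact_thickMul_thickRed g _ _
  have hminj : Function.Injective (thickMul g (L + c) 1 (L + c + 1) (by omega)) :=
    thickMul_injective g hg (by omega)
  have hm : ∀ (a : Thick g (L + c + 1)) (x : Thick g 1),
      thickMul g (L + c) 1 (L + c + 1) (by omega) (thickRed g 1 (L + c + 1) (by omega) a * x) =
        a * thickMul g (L + c) 1 (L + c + 1) (by omega) x :=
    fun a x => thickMul_semilinear g _ _ a x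
  obtain ⟨e, he⟩ := IsObs.exists (π := thickRed g (L + c) (L + c + 1) (by omega))
    (m := thickMul g (L + c) 1 (L + c + 1) (by omega)) (u := u (L + c + 1)) (w := u 1)
    (thickRed g 1 (L + c + 1) (by omega)) (hc _ _ _) (thickRed_surjective g _) hex hminj hm
    (hcoc _) τ (by rw [hc]; exact hτ)
  -- `e ∈ F_{L+c} = F_c`: it is the obstruction of a level-`c` section `τ''`
  have heF : e ∈ Fobs u (L + c) := ⟨τ, by rw [hc]; exact hτ, he⟩
  rw [hF] at heF
  obtain ⟨τ'', hτ'', he''⟩ := heF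
  rw [hc c (c + 1) (by omega)] at hτ''
  -- transport `τ''` to level `L + c` by `g^L`: same obstruction class
  have hobs'' : IsObs (thickRed g (L + c) (L + c + 1) (by omega))
      (thickMul g (L + c) 1 (L + c + 1) (by omega)) (u (L + c + 1)) (u 1)
      (cechObjMap y (thickMul g L c (L + c) (by omega)) 0 τ'') e := by
    refine IsObs.map_gamma (π := thickRed g c (c + 1) (by omega))
      (m := thickMul g c 1 (c + 1) (by omega)) (u := u (c + 1))
      (π₂ := thickRed g (L + c) (L + c + 1) (by omega))
      (m₂ := thickMul g (L + c) 1 (L + c + 1) (by omega)) (u₂ := u (L + c + 1))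
      (θ := thickRed g (c + 1) (L + c + 1) (by omega))
      (γ' := thickMul g L c (L + c) (by omega)) (γ := thickMul g L (c + 1) (L + c + 1) (by omega))
      ?_ ?_ ?_ (hc _ _ _) he''
    · apply LinearMap.ext
      intro x
      obtain ⟨x, rfl⟩ := Ideal.Quotient.mk_surjective x
      rfl
    · apply LinearMap.ext
      intro x
      obtain ⟨x, rfl⟩ := Ideal.Quotient.mk_surjective x
      simp only [LinearMap.comp_apply, thickMul_mk]
      congr 1
      ring
    · intro a x
      exact thickMul_semilinear g _ _ a x
  -- the difference has obstruction `0`, hence lifts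
  have h0 : IsObs (thickRed g (L + c) (L + c + 1) (by omega))
      (thickMul g (L + c) 1 (L + c + 1) (by omega)) (u (L + c + 1)) (u 1)
      (τ - cechObjMap y (thickMul g L c (L + c) (by omega)) 0 τ'') 0 := by
    have := he.sub hobs''
    rwa [sub_self] at this
  obtain ⟨τl, hτl, hred⟩ := IsObs.exists_lift (thickRed g 1 (L + c + 1) (by omega)) (hc _ _ _)
    hm hex h0
  refine ⟨τl, hτl, ?_⟩
  -- reduce to level `L`: the transported section dies
  have h1 : cechObjMap y (thickRed g L (L + c + 1) (by omega)).toLinearMap 0 τl =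
      cechObjMap y (thickRed g L (L + c) (by omega)).toLinearMap 0
        (cechObjMap y (thickRed g (L + c) (L + c + 1) (by omega)).toLinearMap 0 τl) := by
    rw [← LinearMap.comp_apply, ← cechObjMap_comp]
    congr 2
    apply LinearMap.ext
    intro x
    exact (thickRed_thickRed g (show L ≤ L + c by omega) (show L + c ≤ L + c + 1 by omega) x).symm
  have h2 : cechObjMap y (thickRed g L (L + c) (by omega)).toLinearMap 0
      (cechObjMap y (thickMul g L c (L + c) (by omega)) 0 τ'') = 0 := by
    rw [← LinearMap.comp_apply, ← cechObjMap_comp]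
    have : (thickRed g L (L + c) (by omega)).toLinearMap ∘ₗ thickMul g L c (L + c) (by omega) = 0 := by
      apply LinearMap.ext
      intro x
      rw [LinearMap.comp_apply, AlgHom.toLinearMap_apply, thickRed_thickMul, LinearMap.zero_apply]
      exact thickMul_eq_zero_of_le _ le_rfl x
    rw [this, cechObjMap_zero', LinearMap.zero_apply]
  rw [h1, hred, map_sub, h2, sub_zero]

/-- **Uniform Mittag-Leffler** for the sections of a compatible family of line bundles on the
punctured spectra of the thickenings `S/(g^L)`: if the obstruction module `E = H²(S/(g), u₁)`
is Noetherian, there is `c₀` such that for every level `L` the images of the level-`L + c`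
sections in the level-`L` sections are the same for all `c ≥ c₀`.
[cite: Grothendieck1968SGA2, Exp. IX, Prop. 1.5 and Exp. XI, 3.16] -/
theorem secIm_stable (hc : IsCompatible u) (hcoc : ∀ L, IsMulCocycle (u L))
    (hg : g ∈ nonZeroDivisors S) [IsNoetherian S (TH2 (u 1))] :
    ∃ n : ℕ, ∀ (L c : ℕ), n ≤ c →
      secIm u L (L + (c + 1)) (by omega) = secIm u L (L + (n + 1)) (by omega) := by
  -- the chain `F_1 ≤ F_2 ≤ ⋯` stabilises
  let f : ℕ →o Submodule S (TH2 (u 1)) :=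
    ⟨fun j => Fobs u (j + 1), fun j j' hjj' => by
      obtain ⟨d, rfl⟩ := Nat.exists_eq_add_of_le hjj'
      show Fobs u (j + 1) ≤ Fobs u (j + d + 1)
      rw [show j + d + 1 = (j + 1) + d by omega]
      exact Fobs_mono hc (j + 1) d⟩
  obtain ⟨n, hn⟩ := (monotone_stabilizes_iff_noetherian.mpr inferInstance) f
  refine ⟨n, fun L c hnc => ?_⟩
  induction c, hnc using Nat.le_induction with
  | base => rfl
  | succ c hnc ih =>
    rw [← ih]
    apply le_antisymm
    · exact secIm_anti hc (by omega) (by omega)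
    · have hF : Fobs u (L + (c + 1)) = Fobs u (c + 1) := by
        have h1 : Fobs u (L + (c + 1)) = f (L + c) := by
          show Fobs u (L + (c + 1)) = Fobs u (L + c + 1)
          rfl
        have h2 : Fobs u (c + 1) = f c := rfl
        rw [h1, h2, ← hn (L + c) (by omega), ← hn c hnc]
      exact secIm_le_secIm_succ hc hcoc hg (by omega) hF

end MittagLeffler

/-! ## The twisted complex of `A` is the complex of the ideal `J` (invertible on the cover) -/

section TwistIso

variable {y M}
variable {A : Type u} [CommRing A] [Algebra R A] (J : Ideal A)

/-- `b ↦ b·a ∈ J` for `a ∈ J`, as an `R`-linear map `A → J`. [folklore] -/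
def mulIntoIdeal (a : A) (ha : a ∈ J) : A →ₗ[R] J where
  toFun b := ⟨b * a, J.mul_mem_left b ha⟩
  map_add' b b' := by
    apply Subtype.ext
    simp [add_mul]
  map_smul' r b := by
    apply Subtype.ext
    simp

/-- After embedding `J_{y_t} ↪ A_{y_t}`, the localised `mulIntoIdeal a` is multiplication by `a/1`.
[folklore] -/
theorem locMap_subtype_locMap_mulIntoIdeal (a : A) (ha : a ∈ J) {n : ℕ} (t : Fin n → Fin s)
    (z : CechLoc y A t) :
    locMap y (J.subtype.restrictScalars R) t (locMap y (mulIntoIdeal J a ha) t z) =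
      z * LocalizedModule.mk a 1 := by
  induction z using LocalizedModule.induction_on with
  | h b sb =>
    rw [locMap_mk, locMap_mk, LocalizedModule.mk_mul_mk, mul_one]
    rfl

variable (a : Fin s → A) (ha : ∀ i, a i ∈ J)

/-- The comparison maps `Φ_n : Č^n(A) → Č^n(J)`, `c(t) ↦ c(t) · a_{t 0}`. [folklore] -/
def twistToIdeal (n : ℕ) : CechObj y A n →ₗ[R] CechObj y J n where
  toFun c t := locMap y (mulIntoIdeal J (a (t 0)) (ha _)) t (c t)
  map_add' c c' := by
    funext t
    simp only [Pi.add_apply, map_add]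
  map_smul' r c := by
    funext t
    simp only [Pi.smul_apply, LinearMap.map_smul, RingHom.id_apply]

/-- Unfolding of `Φ`. [folklore] -/
theorem twistToIdeal_apply (n : ℕ) (c : CechObj y A n) (t : Fin (n + 1) → Fin s) :
    twistToIdeal J a ha n c t = locMap y (mulIntoIdeal J (a (t 0)) (ha _)) t (c t) := rfl

/-- The embedding `Č^n(J) ↪ Č^n(A)`. [folklore] -/
abbrev idealToRing (n : ℕ) : CechObj y J n →ₗ[R] CechObj y A n :=
  cechObjMap y (J.subtype.restrictScalars R) n

/-- `Č^n(J) → Č^n(A)` is injective. [folklore] -/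
theorem idealToRing_injective (n : ℕ) : Function.Injective (idealToRing (y := y) (R := R) J n) :=
  cechObjMap_injective y _ Subtype.val_injective n

/-- `Φ` followed by the embedding is multiplication by `a_{t 0}`. [folklore] -/
theorem idealToRing_twistToIdeal (n : ℕ) (c : CechObj y A n) (t : Fin (n + 1) → Fin s) :
    idealToRing J n (twistToIdeal J a ha n c) t = c t * LocalizedModule.mk (a (t 0)) 1 := by
  rw [cechObjMap_apply, twistToIdeal_apply, locMap_subtype_locMap_mulIntoIdeal]

/-- **`Φ` is a chain map from the twisted complex of `A` to the complex of `J`**, provided the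
twist is `u(i,j) = a_j/a_i`, i.e. `u(i,j) · a_i = a_j` in `A_{y_i y_j}`. [folklore] -/
theorem twistToIdeal_dT (u : CechObj y A 1)
    (hu : ∀ t : Fin 2 → Fin s, u t * LocalizedModule.mk (a (t 0)) 1 = LocalizedModule.mk (a (t 1)) 1)
    (n : ℕ) (c : CechObj y A n) :
    twistToIdeal J a ha (n + 1) (dT u n c) = dC n (twistToIdeal J a ha n c) := by
  apply idealToRing_injective J (n + 1)
  rw [← dC_cechObjMap]
  funext t
  rw [idealToRing_twistToIdeal, dT_apply, dC_apply, dC_apply, add_mul, Finset.sum_mul]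
  conv_lhs => rw [Fin.sum_univ_succ]
  conv_rhs => rw [Fin.sum_univ_succ]
  -- the twist relation restricted to `t`
  have hut : uAt u t 0 1 * LocalizedModule.mk (a (t 0)) 1 = LocalizedModule.mk (a (t 1)) 1 := by
    have := congrArg (res y A t ![0, 1]) (hu (t ∘ ![0, 1]))
    rw [res_mul, res_mk_one, res_mk_one] at this
    exact this
  -- the face-`0` term picks up `a_{t 1}`, the others `a_{t 0}`
  have face0 : res y A t (Fin.succAbove 0)
      (idealToRing J n (twistToIdeal J a ha n c) (t ∘ Fin.succAbove 0)) =
      res y A t (Fin.succAbove 0) (c (t ∘ Fin.succAbove 0)) * LocalizedModule.mk (a (t 1)) 1 := by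
    rw [idealToRing_twistToIdeal, res_mul, res_mk_one]
    rfl
  have facei : ∀ i : Fin (n + 1), res y A t (Fin.succAbove i.succ)
      (idealToRing J n (twistToIdeal J a ha n c) (t ∘ Fin.succAbove i.succ)) =
      res y A t (Fin.succAbove i.succ) (c (t ∘ Fin.succAbove i.succ)) *
        LocalizedModule.mk (a (t 0)) 1 := by
    intro i
    rw [idealToRing_twistToIdeal, res_mul, res_mk_one]
    have : (t ∘ Fin.succAbove i.succ) 0 = t 0 := by
      show t (Fin.succAbove i.succ 0) = t 0
      rw [Fin.succ_succAbove_zero]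
    rw [this]
  rw [face0]
  simp only [facei, smul_mul_assoc]
  rw [← hut]
  simp only [Fin.val_zero, pow_zero, one_smul]
  ring

/-- `y_t = y_{t 0} · y_{t ∘ succ}`. [folklore] -/
theorem tupleProd_eq_mul_tupleProd_succ {n : ℕ} (t : Fin (n + 1) → Fin s) :
    tupleProd y t = y (t 0) * tupleProd y (t ∘ Fin.succ) := by
  unfold tupleProd
  rw [Fin.prod_univ_succ]
  rfl

/-- **`Φ_n` is onto** when `y_i J ⊆ a_i A` for all `i` (the cover property). [folklore] -/
theorem twistToIdeal_surjective (hcov : ∀ (i : Fin s) (b : A), b ∈ J → ∃ c : A, y i • b = c * a i)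
    (n : ℕ) : Function.Surjective (twistToIdeal (y := y) J a ha n) := by
  intro w
  have key : ∀ t : Fin (n + 1) → Fin s, ∃ z : CechLoc y A t,
      locMap y (mulIntoIdeal J (a (t 0)) (ha _)) t z = w t := by
    intro t
    generalize w t = wt
    induction wt using LocalizedModule.induction_on with
    | h j sj =>
      obtain ⟨_, k, rfl⟩ := sj
      obtain ⟨c, hc⟩ := hcov (t 0) j j.2
      refine ⟨LocalizedModule.mk (tupleProd y (t ∘ Fin.succ) • c)
        ⟨tupleProd y t ^ (k + 1), k + 1, rfl⟩, ?_⟩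
      rw [locMap_mk]
      have hp : (⟨tupleProd y t ^ (k + 1), k + 1, rfl⟩ : Submonoid.powers (tupleProd y t)) =
          (⟨tupleProd y t, 1, pow_one _⟩ : Submonoid.powers (tupleProd y t)) *
            (⟨tupleProd y t ^ k, k, rfl⟩ : Submonoid.powers (tupleProd y t)) := by
        apply Subtype.ext
        simp [pow_succ']
      rw [hp, ← LocalizedModule.mk_cancel_common_left
        (⟨tupleProd y t, 1, pow_one _⟩ : Submonoid.powers (tupleProd y t))
        (⟨tupleProd y t ^ k, k, rfl⟩ : Submonoid.powers (tupleProd y t)) j]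
      congr 1
      apply Subtype.ext
      rw [Submonoid.smul_def]
      simp only [mulIntoIdeal, LinearMap.coe_mk, AddHom.coe_mk, Submodule.coe_smul_of_tower]
      rw [tupleProd_eq_mul_tupleProd_succ t, mul_comm (y (t 0)), mul_smul, hc, smul_mul_assoc]
  choose z hz using key
  exact ⟨z, funext fun t => hz t⟩

/-- **`Φ_n` is injective** when `a_{t 0}` is a non-zero-divisor of every `A_{y_t}`. [folklore] -/
theorem twistToIdeal_injective
    (hreg : ∀ {n : ℕ} (t : Fin (n + 1) → Fin s) (z : CechLoc y A t),
      z * LocalizedModule.mk (a (t 0)) 1 = 0 → z = 0)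
    (n : ℕ) : Function.Injective (twistToIdeal (y := y) J a ha n) := by
  rw [injective_iff_map_eq_zero]
  intro c hc
  funext t
  apply hreg t
  rw [← idealToRing_twistToIdeal J a ha n c t, hc, map_zero, Pi.zero_apply]

/-- The non-zero-divisor condition from a global non-zero-divisor `c₀ ∈ J` and the cover property:
`y_{t0} c₀ = c' a_{t0}` makes `a_{t0}/1` divide the non-zero-divisor `y_{t0} c₀ / 1`. [folklore] -/
theorem mul_mk_eq_zero_imp_of_cover (hcov : ∀ (i : Fin s) (b : A), b ∈ J → ∃ c : A, y i • b = c * a i)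
    (c₀ : A) (hc₀J : c₀ ∈ J) (hc₀ : ∀ b : A, b * c₀ = 0 → b = 0)
    {n : ℕ} (t : Fin (n + 1) → Fin s) (z : CechLoc y A t)
    (hz : z * LocalizedModule.mk (a (t 0)) 1 = 0) : z = 0 := by
  -- `z · c₀/1 = 0` implies `z = 0`
  have step1 : ∀ z : CechLoc y A t, z * LocalizedModule.mk c₀ 1 = 0 → z = 0 := by
    intro z hz
    induction z using LocalizedModule.induction_on with
    | h b sb =>
      rw [LocalizedModule.mk_mul_mk, mul_one, ← LocalizedModule.zero_mk sb, LocalizedModule.mk_eq] at hz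
      obtain ⟨v, hv⟩ := hz
      rw [← LocalizedModule.zero_mk sb, LocalizedModule.mk_eq]
      refine ⟨v, ?_⟩
      simp only [smul_zero] at hv ⊢
      rw [Submonoid.smul_def, Submonoid.smul_def, smul_smul] at hv ⊢
      apply hc₀
      rw [smul_mul_assoc]
      exact hv
  apply step1
  -- `y_{t0} • (z · c₀/1) = z · (c' a_{t0})/1 = 0`
  obtain ⟨c', hc'⟩ := hcov (t 0) c₀ hc₀J
  have h1 : (y (t 0)) • (z * LocalizedModule.mk c₀ 1) = 0 := by
    have hsplit : LocalizedModule.mk (c' * a (t 0)) (1 : Submonoid.powers (tupleProd y t)) =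
        LocalizedModule.mk c' 1 * LocalizedModule.mk (a (t 0)) 1 := by
      rw [LocalizedModule.mk_mul_mk, mul_one]
    rw [← mul_smul_comm, LocalizedModule.smul'_mk, hc', hsplit, mul_comm (LocalizedModule.mk c' 1),
      ← mul_assoc, hz, zero_mul]
  have hdvd : ∃ K, tupleProd y ![t 0] ∣ tupleProd y t ^ K := by
    refine ⟨1, ?_⟩
    rw [pow_one, show tupleProd y ![t 0] = y (t 0) by simp [tupleProd]]
    exact Finset.dvd_prod_of_mem (fun k => y (t k)) (Finset.mem_univ 0)
  exact smul_injective_cechLoc_of_dvd hdvd ⟨tupleProd y ![t 0], 1, pow_one _⟩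
    (by rw [smul_zero]; simpa [tupleProd] using h1)

variable (u : CechObj y A 1)
  (hu : ∀ t : Fin 2 → Fin s, u t * LocalizedModule.mk (a (t 0)) 1 = LocalizedModule.mk (a (t 1)) 1)

/-- `Φ₁` restricted to twisted cocycles lands in cocycles. [folklore] -/
def twistToIdealZ1 : TZ1 u →ₗ[R] Z1 (y := y) (M := J) :=
  (twistToIdeal J a ha 1).restrict (p := TZ1 u) (q := Z1 (y := y) (M := J)) fun x hx => by
    rw [LinearMap.mem_ker] at hx ⊢
    rw [← twistToIdeal_dT J a ha u hu, hx, map_zero]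

/-- **The comparison map `H²(A, u) → H²(J)`** induced by `Φ`. [folklore] -/
def twistToIdealH2 : TH2 u →ₗ[R] H2 (y := y) (M := J) :=
  Submodule.mapQ (TB1 u) (B1 (y := y) (M := J)) (twistToIdealZ1 J a ha u hu) fun x hx => by
    simp only [Submodule.mem_comap, Submodule.coe_subtype, LinearMap.mem_range] at hx ⊢
    obtain ⟨ξ, hξ⟩ := hx
    refine ⟨twistToIdeal J a ha 0 ξ, ?_⟩
    rw [← twistToIdeal_dT J a ha u hu, hξ]
    rfl

/-- The comparison map on `H²` is injective when `Φ₀` is onto and `Φ₁` is injective. [folklore] -/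
theorem twistToIdealH2_injective (h0 : Function.Surjective (twistToIdeal (y := y) J a ha 0))
    (h1 : Function.Injective (twistToIdeal (y := y) J a ha 1)) :
    Function.Injective (twistToIdealH2 J a ha u hu) := by
  rw [injective_iff_map_eq_zero]
  intro e he
  obtain ⟨⟨x, hx⟩, rfl⟩ := Submodule.Quotient.mk_surjective _ e
  have he' : (twistToIdealZ1 J a ha u hu ⟨x, hx⟩ : CechObj y J 1) ∈
      LinearMap.range (dC (y := y) (M := J) 0) := by
    have : Submodule.mapQ (TB1 u) (B1 (y := y) (M := J)) (twistToIdealZ1 J a ha u hu) _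
        (Submodule.Quotient.mk ⟨x, hx⟩) = 0 := he
    rw [Submodule.mapQ_apply, Submodule.Quotient.mk_eq_zero] at this
    exact this
  obtain ⟨w, hw⟩ := he'
  obtain ⟨ξ, rfl⟩ := h0 w
  rw [← twistToIdeal_dT J a ha u hu] at hw
  have hx' : x = dT u 0 ξ := h1 hw.symm
  rw [Submodule.Quotient.mk_eq_zero]
  simp only [Submodule.mem_comap, Submodule.coe_subtype, LinearMap.mem_range]
  exact ⟨ξ, hx'.symm⟩

include ha hu in
/-- **`H²(A, u)` is Noetherian when `H²(J)` is**, under the cover and non-zero-divisor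
hypotheses. [folklore] -/
theorem isNoetherian_TH2_of_cover [IsNoetherian R (H2 (y := y) (M := J))]
    (hcov : ∀ (i : Fin s) (b : A), b ∈ J → ∃ c : A, y i • b = c * a i)
    (c₀ : A) (hc₀J : c₀ ∈ J) (hc₀ : ∀ b : A, b * c₀ = 0 → b = 0) :
    IsNoetherian R (TH2 u) :=
  isNoetherian_of_injective (twistToIdealH2 J a ha u hu)
    (twistToIdealH2_injective J a ha u hu (twistToIdeal_surjective J a ha hcov 0)
      (twistToIdeal_injective J a ha (fun t z hz => mul_mk_eq_zero_imp_of_cover J a hcov c₀ hc₀J hc₀ t z hz) 1))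

end TwistIso

/-! ## The unit cocycle `u(i,j) = a_j / a_i` of an ideal invertible on the cover -/

section CoverCocycle

variable {y M}
variable {A : Type u} [CommRing A] [Algebra R A] (J : Ideal A) (a : Fin s → A) (ha : ∀ i, a i ∈ J)
  (hcov : ∀ (i : Fin s) (b : A), b ∈ J → ∃ c : A, y i • b = c * a i)

/-- `y_t = y_{t 0} y_{t 1}` for an edge. [folklore] -/
theorem tupleProd_two (t : Fin 2 → Fin s) : tupleProd y t = y (t 0) * y (t 1) := by
  simp [tupleProd, Fin.prod_univ_two]

include hcov in
/-- On `A_{y_i y_j}`, `a_j/1` is a multiple of `a_i/1`. [folklore] -/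
theorem exists_mul_mk_eq_mk (t : Fin 2 → Fin s) (b : A) (hb : b ∈ J) :
    ∃ z : CechLoc y A t, z * LocalizedModule.mk (a (t 0)) 1 = LocalizedModule.mk b 1 := by
  obtain ⟨c, hc⟩ := hcov (t 0) b hb
  refine ⟨LocalizedModule.mk (y (t 1) • c) ⟨tupleProd y t, 1, pow_one _⟩, ?_⟩
  rw [LocalizedModule.mk_mul_mk, mul_one, smul_mul_assoc, ← hc, smul_smul, mul_comm (y (t 1)),
    ← tupleProd_two, ← Submonoid.smul_def (⟨tupleProd y t, 1, pow_one _⟩ : Submonoid.powers (tupleProd y t)) b,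
    LocalizedModule.mk_cancel]

/-- **The transition cocycle** of the ideal `J` on the cover `D(y_i)`: `u(i,j) · a_i = a_j` in
`A_{y_i y_j}` (a choice; unique when `a_i/1` is a non-zero-divisor). [folklore] -/
def coverCocycle : CechObj y A 1 := fun t =>
  Classical.choose (exists_mul_mk_eq_mk (y := y) J a hcov t (a (t 1)) (ha _))

/-- The defining relation of the transition cocycle. [folklore] -/
theorem coverCocycle_spec (t : Fin 2 → Fin s) :
    coverCocycle J a ha hcov t * LocalizedModule.mk (a (t 0)) 1 = LocalizedModule.mk (a (t 1)) 1 :=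
  Classical.choose_spec (exists_mul_mk_eq_mk (y := y) J a hcov t (a (t 1)) (ha _))

/-- The defining relation restricted to a simplex: `u(t a, t b) · a_{t a} = a_{t b}`. [folklore] -/
theorem uAt_coverCocycle_mul {n : ℕ} (t : Fin (n + 1) → Fin s) (i j : Fin (n + 1)) :
    uAt (coverCocycle J a ha hcov) t i j * LocalizedModule.mk (a (t i)) 1 =
      LocalizedModule.mk (a (t j)) 1 := by
  have := congrArg (res y A t ![i, j]) (coverCocycle_spec J a ha hcov (t ∘ ![i, j]))
  rw [res_mul, res_mk_one, res_mk_one] at this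
  exact this

variable (hreg : ∀ {n : ℕ} (t : Fin (n + 1) → Fin s) (z : CechLoc y A t),
  z * LocalizedModule.mk (a (t 0)) 1 = 0 → z = 0)

include J ha hcov hreg in
/-- Regularity of `a_{t i}/1` for every vertex `i`: `u(i,0) a_i = a_0`, so `z a_i = 0` forces
`z a_0 = 0`. [folklore] -/
theorem mul_mk_vertex_eq_zero_imp {n : ℕ} (t : Fin (n + 1) → Fin s) (i : Fin (n + 1))
    (z : CechLoc y A t) (hz : z * LocalizedModule.mk (a (t i)) 1 = 0) : z = 0 := by
  apply hreg t
  rw [← uAt_coverCocycle_mul J a ha hcov t i 0, ← mul_assoc, mul_comm z, mul_assoc, hz, mul_zero]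

include hreg in
/-- The transition cocycle is multiplicative. [folklore] -/
theorem isMulCocycle_coverCocycle : IsMulCocycle (coverCocycle (y := y) J a ha hcov) := by
  apply isMulCocycle_of_uAt_mul
  intro t
  have h01 := uAt_coverCocycle_mul J a ha hcov t 0 1
  have h12 := uAt_coverCocycle_mul J a ha hcov t 1 2
  have h02 := uAt_coverCocycle_mul J a ha hcov t 0 2
  have : (uAt (coverCocycle J a ha hcov) t 0 1 * uAt (coverCocycle J a ha hcov) t 1 2 -
      uAt (coverCocycle J a ha hcov) t 0 2) * LocalizedModule.mk (a (t 0)) 1 = 0 := by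
    rw [sub_mul, h02, mul_comm (uAt _ t 0 1), mul_assoc, h01, h12, sub_self]
  exact sub_eq_zero.mp (hreg t _ this)

include hreg in
/-- The transition cocycle consists of units (`u(i,j) u(j,i) = 1`). [folklore] -/
theorem isUnit_coverCocycle (t : Fin 2 → Fin s) : IsUnit (coverCocycle (y := y) J a ha hcov t) := by
  obtain ⟨v, hv⟩ := exists_mul_mk_eq_mk (y := y) J a hcov (t ∘ ![1, 0]) (a (t 0)) (ha _)
  -- `v · a_{t 1} = a_{t 0}` in `A_{y_{t 1} y_{t 0}}`; move it to `A_{y_t}` along the swap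
  have hv' : res y A t ![1, 0] v * LocalizedModule.mk (a (t 1)) 1 = LocalizedModule.mk (a (t 0)) 1 := by
    have := congrArg (res y A t ![1, 0]) hv
    rw [res_mul, res_mk_one, res_mk_one] at this
    exact this
  have hu := coverCocycle_spec J a ha hcov t
  refine IsUnit.of_mul_eq_one (res y A t ![1, 0] v) ?_
  have : (coverCocycle J a ha hcov t * res y A t ![1, 0] v - 1) * LocalizedModule.mk (a (t 0)) 1 = 0 := by
    rw [sub_mul, one_mul, mul_comm (coverCocycle J a ha hcov t), mul_assoc, hu, hv', sub_self]
  exact sub_eq_zero.mp (hreg t _ this)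

end CoverCocycle

/-! ## The compatible family of unit cocycles on all thickenings (formal line bundle) -/

section Family

variable {S : Type u} [CommRing S] (g : S) {s : ℕ} (y : Fin s → S)

/-- Localisations of a trivial module are trivial. [folklore] -/
theorem cechLoc_subsingleton {M' : Type u} [AddCommGroup M'] [Module S M'] [Subsingleton M']
    {n : ℕ} (t : Fin n → Fin s) : Subsingleton (CechLoc y M' t) := by
  refine ⟨fun z w => ?_⟩
  induction z using LocalizedModule.induction_on with
  | h m sm =>
    induction w using LocalizedModule.induction_on with
    | h m' sm' =>
      rw [Subsingleton.elim m 0, Subsingleton.elim m' 0, LocalizedModule.zero_mk,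
        LocalizedModule.zero_mk]

/-- `S/(g^0)` is trivial. [folklore] -/
instance thick_zero_subsingleton : Subsingleton (Thick g 0) := by
  rw [Ideal.Quotient.subsingleton_iff, pow_zero, Ideal.span_singleton_one]

variable (hg : g ∈ nonZeroDivisors S)
  (hH3 : ∀ z : CechObj y (Thick g 1) 2, dC 2 z = 0 → ∃ v : CechObj y (Thick g 1) 1, dC 1 v = z)
  (u1 : CechObj y (Thick g 1) 1) (h1 : IsMulCocycle u1 ∧ ∀ t, IsUnit (u1 t))

/-- **The formal lift**: unit cocycles `u_{k+1}` on `S/(g^{k+1})`, `k ≥ 0`, each reducing to the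
previous one, obtained from `u₁` by iterating `exists_lift_mulCocycle` (which needs
`H³_𝔪(S/(g)) = 0`). [cite: Grothendieck1968SGA2, Exp. XI, 3.16 and proof of 3.13] -/
noncomputable def liftFam : (k : ℕ) →
    {u : CechObj y (Thick g (k + 1)) 1 // IsMulCocycle u ∧ ∀ t, IsUnit (u t)}
  | 0 => ⟨u1, h1⟩
  | k + 1 =>
    let prev := liftFam k
    let ex := exists_lift_mulCocycle (y := y) (π := thickRed g (k + 1) (k + 2) (by omega))
      (thickRed_surjective g _) (m := thickMul g (k + 1) 1 (k + 2) (by omega))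
      (exact_thickMul_thickRed g _ _) (thickMul_injective g hg (by omega))
      (fun x x' => thickMul_mul_thickMul g _ (by omega) x x') hH3 prev.1 prev.2.1 prev.2.2
    ⟨Classical.choose ex, (Classical.choose_spec ex).1, (Classical.choose_spec ex).2.1⟩

/-- Each lift reduces to the previous cocycle. [folklore] -/
theorem liftFam_red (k : ℕ) :
    cechObjMap y (thickRed g (k + 1) (k + 2) (by omega)).toLinearMap 1 (liftFam g y hg hH3 u1 h1 (k + 1)).1 =
      (liftFam g y hg hH3 u1 h1 k).1 := by
  have ex := exists_lift_mulCocycle (y := y) (π := thickRed g (k + 1) (k + 2) (by omega))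
      (thickRed_surjective g _) (m := thickMul g (k + 1) 1 (k + 2) (by omega))
      (exact_thickMul_thickRed g _ _) (thickMul_injective g hg (by omega))
      (fun x x' => thickMul_mul_thickMul g _ (by omega) x x') hH3 (liftFam g y hg hH3 u1 h1 k).1
      (liftFam g y hg hH3 u1 h1 k).2.1 (liftFam g y hg hH3 u1 h1 k).2.2
  have hdef : (liftFam g y hg hH3 u1 h1 (k + 1)).1 = Classical.choose ex := rfl
  rw [hdef]
  exact (Classical.choose_spec ex).2.2

/-- The family on all levels (`0` at the trivial level `0`). [folklore] -/
noncomputable def uFam : (L : ℕ) → CechObj y (Thick g L) 1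
  | 0 => 0
  | k + 1 => (liftFam g y hg hH3 u1 h1 k).1

/-- The family starts with `u₁`. [folklore] -/
theorem uFam_one : uFam g y hg hH3 u1 h1 1 = u1 := rfl

/-- Every member of the family is a multiplicative cocycle. [folklore] -/
theorem isMulCocycle_uFam (L : ℕ) : IsMulCocycle (uFam g y hg hH3 u1 h1 L) := by
  cases L with
  | zero =>
    intro t
    haveI := cechLoc_subsingleton y (M' := Thick g 0) t
    exact Subsingleton.elim _ _
  | succ k => exact (liftFam g y hg hH3 u1 h1 k).2.1

/-- Every member of the family (level `≥ 1`) consists of units. [folklore] -/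
theorem isUnit_uFam {L : ℕ} (hL : 1 ≤ L) (t : Fin 2 → Fin s) : IsUnit (uFam g y hg hH3 u1 h1 L t) := by
  obtain ⟨k, rfl⟩ := Nat.exists_eq_add_of_le' hL
  exact (liftFam g y hg hH3 u1 h1 k).2.2 t

omit [CommRing S] in
/-- `Č^n` of the identity is the identity. [folklore] -/
theorem cechObjMap_id' {R' : Type u} [CommRing R'] {s' : ℕ} (y' : Fin s' → R') {N : Type u}
    [AddCommGroup N] [Module R' N] (n : ℕ) :
    cechObjMap y' (LinearMap.id : N →ₗ[R'] N) n = LinearMap.id := by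
  have := cechObjMap_smul_id (y := y') (M := N) 1 n
  rwa [one_smul, one_smul] at this

/-- One reduction step. [folklore] -/
theorem uFam_red_succ {n : ℕ} (hn : 1 ≤ n) :
    cechObjMap y (thickRed g n (n + 1) (by omega)).toLinearMap 1 (uFam g y hg hH3 u1 h1 (n + 1)) =
      uFam g y hg hH3 u1 h1 n := by
  obtain ⟨k, rfl⟩ := Nat.exists_eq_add_of_le' hn
  exact liftFam_red g y hg hH3 u1 h1 k

/-- The family is compatible with all reductions. [folklore] -/
theorem isCompatible_uFam : IsCompatible (uFam g y hg hH3 u1 h1) := by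
  intro L L' h
  obtain ⟨d, rfl⟩ := Nat.exists_eq_add_of_le h
  rcases Nat.eq_zero_or_pos L with hL | hL
  · subst hL
    funext t
    haveI := cechLoc_subsingleton y (M' := Thick g 0) t
    exact Subsingleton.elim _ _
  induction d with
  | zero =>
    show cechObjMap y (thickRed g L L h).toLinearMap 1 (uFam g y hg hH3 u1 h1 L) = _
    have hid : thickRed g L L h = AlgHom.id S _ := by
      apply AlgHom.ext
      intro x
      obtain ⟨x, rfl⟩ := Ideal.Quotient.mk_surjective x
      rfl
    rw [hid, AlgHom.toLinearMap_id, cechObjMap_id', LinearMap.id_apply]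
  | succ d ih =>
    have hcomp : (thickRed g L (L + (d + 1)) h).toLinearMap =
        (thickRed g L (L + d) (by omega)).toLinearMap ∘ₗ
          (thickRed g (L + d) (L + d + 1) (by omega)).toLinearMap := by
      apply LinearMap.ext
      intro x
      obtain ⟨x, rfl⟩ := Ideal.Quotient.mk_surjective x
      rfl
    show cechObjMap y (thickRed g L (L + (d + 1)) h).toLinearMap 1 (uFam g y hg hH3 u1 h1 (L + d + 1)) = _
    rw [hcomp, cechObjMap_comp, LinearMap.comp_apply, uFam_red_succ g y hg hH3 u1 h1 (by omega)]
    exact ih (by omega)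

end Family

/-! ## The limit module of the stable sections (the algebraization `N = lim Γ(U_L, L_L)`) -/

section Limit

variable {S : Type u} [CommRing S] {g : S} {s : ℕ} {y : Fin s → S}
variable {u : ∀ L : ℕ, CechObj y (Thick g L) 1} (n : ℕ)

/-- Index congruence for `secIm`. [folklore] -/
theorem secIm_congr {L X X' : ℕ} (hX : X = X') (h : L ≤ X) (h' : L ≤ X') :
    secIm u L X h = secIm u L X' h' := by
  subst hX
  rfl

variable (u) in
/-- The stable image `I_L = im(Γ_{L+n+1} → Γ_L)` (`n` the Mittag-Leffler constant). [folklore] -/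
def Istab (L : ℕ) : Submodule S (CechObj y (Thick g L) 0) := secIm u L (L + (n + 1)) (by omega)

/-- Stable images consist of sections. [folklore] -/
theorem Istab_le_TZ0 (hc : IsCompatible u) (L : ℕ) : Istab u n L ≤ TZ0 (u L) := by
  intro σ hσ
  rw [Istab, mem_secIm_iff] at hσ
  obtain ⟨τ, hτ, rfl⟩ := hσ
  exact dT_cechObjMap_thickRed hc _ τ hτ

/-- Reductions map stable images into stable images. [folklore] -/
theorem cechObjMap_thickRed_mem_Istab (hc : IsCompatible u) {L L' : ℕ} (h : L ≤ L')
    {σ : CechObj y (Thick g L') 0} (hσ : σ ∈ Istab u n L') :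
    cechObjMap y (thickRed g L L' h).toLinearMap 0 σ ∈ Istab u n L := by
  rw [Istab, mem_secIm_iff] at hσ
  obtain ⟨τ, hτ, rfl⟩ := hσ
  have : cechObjMap y (thickRed g L L' h).toLinearMap 0
      (cechObjMap y (thickRed g L' (L' + (n + 1)) (by omega)).toLinearMap 0 τ) ∈
      secIm u L (L' + (n + 1)) (by omega) := by
    rw [mem_secIm_iff]
    refine ⟨τ, hτ, ?_⟩
    rw [← LinearMap.comp_apply, ← cechObjMap_comp]
    congr 2
    apply LinearMap.ext
    intro x
    exact (thickRed_thickRed g h (show L' ≤ L' + (n + 1) by omega) x).symm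
  exact secIm_anti hc (show L ≤ L + (n + 1) by omega) (show L + (n + 1) ≤ L' + (n + 1) by omega) this

/-- Under uniform Mittag-Leffler, the reduction maps `I_{L+1}` onto `I_L`. [folklore] -/
theorem exists_red_eq_of_mem_Istab
    (hstab : ∀ (L c : ℕ), n ≤ c → secIm u L (L + (c + 1)) (by omega) = secIm u L (L + (n + 1)) (by omega))
    (L : ℕ) {σ : CechObj y (Thick g L) 0} (hσ : σ ∈ Istab u n L) :
    ∃ τ ∈ Istab u n (L + 1), cechObjMap y (thickRed g L (L + 1) (by omega)).toLinearMap 0 τ = σ := by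
  -- `σ ∈ I_L = secIm L (L + (n+2))`, i.e. the reduction of a level-`L+n+2` section `ρ`
  have hσ' : σ ∈ secIm u L (L + (n + 1 + 1)) (by omega) := by
    rw [hstab L (n + 1) (by omega)]
    exact hσ
  rw [mem_secIm_iff] at hσ'
  obtain ⟨ρ, hρ, rfl⟩ := hσ'
  refine ⟨cechObjMap y (thickRed g (L + 1) (L + (n + 1 + 1)) (by omega)).toLinearMap 0 ρ, ?_, ?_⟩
  · rw [Istab, secIm_congr (show L + 1 + (n + 1) = L + (n + 1 + 1) by omega) _ (by omega),
      mem_secIm_iff]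
    exact ⟨ρ, hρ, rfl⟩
  · rw [← LinearMap.comp_apply, ← cechObjMap_comp]
    congr 2
    apply LinearMap.ext
    intro x
    exact thickRed_thickRed g (show L ≤ L + 1 by omega) (show L + 1 ≤ L + (n + 1 + 1) by omega) x

variable (u) in
/-- **The limit module** `N = lim_L I_L`: compatible sequences of stable sections.
[cite: Grothendieck1968SGA2, Exp. IX, 2.2 / Exp. XI, 3.16] -/
def Nlim : Submodule S (∀ L : ℕ, CechObj y (Thick g L) 0) where
  carrier := {σ | (∀ L, σ L ∈ Istab u n L) ∧
    ∀ L, cechObjMap y (thickRed g L (L + 1) (by omega)).toLinearMap 0 (σ (L + 1)) = σ L}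
  add_mem' := by
    rintro σ τ ⟨hσ, hσ'⟩ ⟨hτ, hτ'⟩
    exact ⟨fun L => Submodule.add_mem _ (hσ L) (hτ L), fun L => by
      rw [Pi.add_apply, Pi.add_apply, map_add, hσ', hτ']⟩
  zero_mem' := ⟨fun L => Submodule.zero_mem _, fun L => by simp⟩
  smul_mem' := by
    rintro r σ ⟨hσ, hσ'⟩
    exact ⟨fun L => Submodule.smul_mem _ r (hσ L), fun L => by
      rw [Pi.smul_apply, Pi.smul_apply, LinearMap.map_smul, hσ']⟩

/-- Membership in the limit module. [folklore] -/
theorem mem_Nlim_iff (σ : ∀ L : ℕ, CechObj y (Thick g L) 0) :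
    σ ∈ Nlim u n ↔ (∀ L, σ L ∈ Istab u n L) ∧
      ∀ L, cechObjMap y (thickRed g L (L + 1) (by omega)).toLinearMap 0 (σ (L + 1)) = σ L :=
  Iff.rfl

/-- Compatibility along arbitrary reductions. [folklore] -/
theorem Nlim_red {σ : ∀ L : ℕ, CechObj y (Thick g L) 0} (hσ : σ ∈ Nlim u n) {L L' : ℕ}
    (h : L ≤ L') : cechObjMap y (thickRed g L L' h).toLinearMap 0 (σ L') = σ L := by
  obtain ⟨d, rfl⟩ := Nat.exists_eq_add_of_le h
  induction d with
  | zero =>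
    have hid : thickRed g L (L + 0) h = AlgHom.id S _ := by
      apply AlgHom.ext
      intro x
      obtain ⟨x, rfl⟩ := Ideal.Quotient.mk_surjective x
      rfl
    rw [hid, AlgHom.toLinearMap_id, cechObjMap_id', LinearMap.id_apply]
    rfl
  | succ d ih =>
    have hcomp : (thickRed g L (L + (d + 1)) h).toLinearMap =
        (thickRed g L (L + d) (by omega)).toLinearMap ∘ₗ
          (thickRed g (L + d) (L + d + 1) (by omega)).toLinearMap := by
      apply LinearMap.ext
      intro x
      obtain ⟨x, rfl⟩ := Ideal.Quotient.mk_surjective x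
      rfl
    rw [hcomp, cechObjMap_comp, LinearMap.comp_apply]
    erw [hσ.2 (L + d)]
    exact ih (by omega)

/-- **The projections `N → I_L` are onto** (uniform Mittag-Leffler). [folklore] -/
theorem exists_mem_Nlim_apply_eq (hc : IsCompatible u)
    (hstab : ∀ (L c : ℕ), n ≤ c → secIm u L (L + (c + 1)) (by omega) = secIm u L (L + (n + 1)) (by omega))
    (L : ℕ) {x : CechObj y (Thick g L) 0} (hx : x ∈ Istab u n L) :
    ∃ σ ∈ Nlim u n, σ L = x := by
  classical
  -- go up from level `L` step by step
  have step : ∀ (k : ℕ) (z : {z : CechObj y (Thick g (L + k)) 0 // z ∈ Istab u n (L + k)}),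
      ∃ z' : {z : CechObj y (Thick g (L + (k + 1))) 0 // z ∈ Istab u n (L + (k + 1))},
        cechObjMap y (thickRed g (L + k) (L + (k + 1)) (by omega)).toLinearMap 0 z'.1 = z.1 := by
    intro k z
    obtain ⟨τ, hτ, hred⟩ := exists_red_eq_of_mem_Istab n hstab (L + k) z.2
    exact ⟨⟨τ, hτ⟩, hred⟩
  let up : (k : ℕ) → {z : CechObj y (Thick g (L + k)) 0 // z ∈ Istab u n (L + k)} :=
    fun k => Nat.rec (motive := fun k => {z : CechObj y (Thick g (L + k)) 0 // z ∈ Istab u n (L + k)})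
      ⟨x, hx⟩ (fun k z => Classical.choose (step k z)) k
  have up_zero : (up 0).1 = x := rfl
  have up_succ : ∀ k, cechObjMap y (thickRed g (L + k) (L + (k + 1)) (by omega)).toLinearMap 0
      (up (k + 1)).1 = (up k).1 := fun k => Classical.choose_spec (step k (up k))
  -- reductions of `up`
  have up_red : ∀ (k m : ℕ) (hkm : k ≤ m),
      cechObjMap y (thickRed g (L + k) (L + m) (by omega)).toLinearMap 0 (up m).1 = (up k).1 := by
    intro k m hkm
    induction m, hkm using Nat.le_induction with
    | base =>
      have hid : thickRed g (L + k) (L + k) (by omega) = AlgHom.id S _ := by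
        apply AlgHom.ext
        intro x
        obtain ⟨x, rfl⟩ := Ideal.Quotient.mk_surjective x
        rfl
      rw [hid, AlgHom.toLinearMap_id, cechObjMap_id', LinearMap.id_apply]
    | succ m hkm ih =>
      have hcomp : (thickRed g (L + k) (L + (m + 1)) (by omega)).toLinearMap =
          (thickRed g (L + k) (L + m) (by omega)).toLinearMap ∘ₗ
            (thickRed g (L + m) (L + (m + 1)) (by omega)).toLinearMap := by
        apply LinearMap.ext
        intro x
        obtain ⟨x, rfl⟩ := Ideal.Quotient.mk_surjective x
        rfl
      rw [hcomp, cechObjMap_comp, LinearMap.comp_apply, up_succ m]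
      exact ih
  -- the compatible sequence through `x`
  refine ⟨fun M => cechObjMap y (thickRed g M (L + M) (by omega)).toLinearMap 0 (up M).1, ⟨?_, ?_⟩, ?_⟩
  · intro M
    exact cechObjMap_thickRed_mem_Istab n hc _ (up M).2
  · intro M
    dsimp only
    rw [← LinearMap.comp_apply, ← cechObjMap_comp]
    have hcomp : (thickRed g M (M + 1) (by omega)).toLinearMap ∘ₗ
        (thickRed g (M + 1) (L + (M + 1)) (by omega)).toLinearMap =
        (thickRed g M (L + M) (by omega)).toLinearMap ∘ₗ
          (thickRed g (L + M) (L + (M + 1)) (by omega)).toLinearMap := by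
      apply LinearMap.ext
      intro x
      obtain ⟨x, rfl⟩ := Ideal.Quotient.mk_surjective x
      rfl
    rw [hcomp, cechObjMap_comp, LinearMap.comp_apply, up_succ M]
  · show cechObjMap y (thickRed g L (L + L) (by omega)).toLinearMap 0 (up L).1 = x
    rw [← up_zero]
    exact up_red 0 L (by omega)

/-- A sequence compatible under the one-step reductions is compatible under all reductions.
[folklore] -/
theorem red_eq_of_step {σ : ∀ L : ℕ, CechObj y (Thick g L) 0}
    (hstep : ∀ L, cechObjMap y (thickRed g L (L + 1) (by omega)).toLinearMap 0 (σ (L + 1)) = σ L)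
    {L L' : ℕ} (h : L ≤ L') : cechObjMap y (thickRed g L L' h).toLinearMap 0 (σ L') = σ L := by
  obtain ⟨d, rfl⟩ := Nat.exists_eq_add_of_le h
  induction d with
  | zero =>
    have hid : thickRed g L (L + 0) h = AlgHom.id S _ := by
      apply AlgHom.ext
      intro x
      obtain ⟨x, rfl⟩ := Ideal.Quotient.mk_surjective x
      rfl
    rw [hid, AlgHom.toLinearMap_id, cechObjMap_id', LinearMap.id_apply]
    rfl
  | succ d ih =>
    have hcomp : (thickRed g L (L + (d + 1)) h).toLinearMap =
        (thickRed g L (L + d) (by omega)).toLinearMap ∘ₗ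
          (thickRed g (L + d) (L + d + 1) (by omega)).toLinearMap := by
      apply LinearMap.ext
      intro x
      obtain ⟨x, rfl⟩ := Ideal.Quotient.mk_surjective x
      rfl
    rw [hcomp, cechObjMap_comp, LinearMap.comp_apply]
    erw [hstep (L + d)]
    exact ih (by omega)

/-- `g · : S/(g^i) → S/(g^i)` (same level) is the scalar action of `g`. [folklore] -/
theorem thickMul_one_self {i : ℕ} (h : i ≤ i + 1) (x : Thick g i) : thickMul g 1 i i h x = g • x := by
  obtain ⟨x, rfl⟩ := Ideal.Quotient.mk_surjective x
  rw [thickMul_mk, pow_one, Algebra.smul_def, Ideal.Quotient.algebraMap_eq, ← map_mul]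

/-- **The kernel of `N → I_1` is `gN`.** [folklore] -/
theorem exists_eq_smul_of_apply_one_eq_zero (hc : IsCompatible u) (hg : g ∈ nonZeroDivisors S)
    {σ : ∀ L : ℕ, CechObj y (Thick g L) 0} (hσ : σ ∈ Nlim u n) (h1 : σ 1 = 0) :
    ∃ τ ∈ Nlim u n, σ = g • τ := by
  classical
  -- `σ_{M+1}` dies at level `1`, hence `σ_{M+1} = g · τ_M` for a unique `τ_M`
  have hex : ∀ M : ℕ, Function.Exact (cechObjMap y (thickMul g 1 M (M + 1) le_rfl) 0)
      (cechObjMap y (thickRed g 1 (M + 1) (by omega)).toLinearMap 0) := fun M =>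
    cechObjMap_exact y _ _ (exact_thickMul_thickRed g le_rfl (by omega)) 0
  have hinj : ∀ M : ℕ, Function.Injective (cechObjMap y (thickMul g 1 M (M + 1) le_rfl) 0) :=
    fun M => cechObjMap_injective y _ (thickMul_injective g hg rfl) 0
  have hinj1 : ∀ M : ℕ, Function.Injective (cechObjMap y (thickMul g 1 M (M + 1) le_rfl) 1) :=
    fun M => cechObjMap_injective y _ (thickMul_injective g hg rfl) 1
  have hker : ∀ M : ℕ, ∃ τ : CechObj y (Thick g M) 0,
      cechObjMap y (thickMul g 1 M (M + 1) le_rfl) 0 τ = σ (M + 1) := by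
    intro M
    apply ((hex M) _).mp
    rw [Nlim_red n hσ (show 1 ≤ M + 1 by omega), h1]
  choose τ hτ using hker
  -- `τ` consists of sections
  have hτZ : ∀ M, dT (u M) 0 (τ M) = 0 := by
    intro M
    apply hinj1 M
    rw [map_zero, ← hc M (M + 1) (by omega), cechObjMap_dT_semilinear (thickRed g M (M + 1) (by omega))
      (thickMul g 1 M (M + 1) le_rfl) (fun a x => thickMul_semilinear g _ _ a x), hτ M]
    exact LinearMap.mem_ker.mp (Istab_le_TZ0 n hc (M + 1) (hσ.1 (M + 1)))
  -- `τ` is compatible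
  have hτstep : ∀ M, cechObjMap y (thickRed g M (M + 1) (by omega)).toLinearMap 0 (τ (M + 1)) = τ M := by
    intro M
    apply hinj M
    rw [hτ M]
    have h2 : cechObjMap y (thickMul g 1 M (M + 1) le_rfl) 0
        (cechObjMap y (thickRed g M (M + 1) (by omega)).toLinearMap 0 (τ (M + 1))) =
        cechObjMap y (thickRed g (M + 1) (M + 2) (by omega)).toLinearMap 0
          (cechObjMap y (thickMul g 1 (M + 1) (M + 2) le_rfl) 0 (τ (M + 1))) := by
      rw [← LinearMap.comp_apply, ← cechObjMap_comp, ← LinearMap.comp_apply, ← cechObjMap_comp]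
      congr 2
      apply LinearMap.ext
      intro x
      rw [LinearMap.comp_apply, LinearMap.comp_apply, AlgHom.toLinearMap_apply,
        AlgHom.toLinearMap_apply, thickMul_thickRed, thickRed_thickMul]
    rw [h2, hτ (M + 1), hσ.2 (M + 1)]
  -- hence `τ_M ∈ I_M`
  have hτI : ∀ M, τ M ∈ Istab u n M := by
    intro M
    rw [Istab, mem_secIm_iff]
    exact ⟨τ (M + (n + 1)), hτZ _, red_eq_of_step hτstep (by omega)⟩
  refine ⟨τ, ⟨hτI, hτstep⟩, ?_⟩
  funext M
  cases M with
  | zero =>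
    haveI : Subsingleton (CechObj y (Thick g 0) 0) := by
      refine ⟨fun a b => funext fun t => ?_⟩
      haveI := cechLoc_subsingleton y (M' := Thick g 0) t
      exact Subsingleton.elim _ _
    exact Subsingleton.elim _ _
  | succ k =>
    rw [Pi.smul_apply, ← hτ k, ← hτstep k, ← LinearMap.comp_apply, ← cechObjMap_comp]
    have : thickMul g 1 k (k + 1) le_rfl ∘ₗ (thickRed g k (k + 1) (by omega)).toLinearMap =
        g • LinearMap.id := by
      apply LinearMap.ext
      intro x
      rw [LinearMap.comp_apply, AlgHom.toLinearMap_apply, thickMul_thickRed, thickMul_one_self,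
        LinearMap.smul_apply, LinearMap.id_apply]
    rw [this, cechObjMap_smul_id, LinearMap.smul_apply, LinearMap.id_apply]

/-- `g` is `N`-regular. [folklore] -/
theorem smul_g_injective_Nlim (hg : g ∈ nonZeroDivisors S) {σ : ∀ L : ℕ, CechObj y (Thick g L) 0}
    (hσ : σ ∈ Nlim u n) (h : g • σ = 0) : σ = 0 := by
  funext M
  have hinj : Function.Injective (cechObjMap y (thickMul g 1 M (M + 1) le_rfl) 0) :=
    cechObjMap_injective y _ (thickMul_injective g hg rfl) 0
  rw [Pi.zero_apply]
  apply hinj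
  rw [map_zero, ← hσ.2 M, ← LinearMap.comp_apply, ← cechObjMap_comp]
  have : thickMul g 1 M (M + 1) le_rfl ∘ₗ (thickRed g M (M + 1) (by omega)).toLinearMap =
      g • LinearMap.id := by
    apply LinearMap.ext
    intro x
    rw [LinearMap.comp_apply, AlgHom.toLinearMap_apply, thickMul_thickRed, thickMul_one_self,
      LinearMap.smul_apply, LinearMap.id_apply]
  rw [this, cechObjMap_smul_id, LinearMap.smul_apply, LinearMap.id_apply, ← Pi.smul_apply g σ, h,
    Pi.zero_apply]

/-- `g^L` kills the level-`L` cochains. [folklore] -/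
theorem pow_smul_cechObj_thick_eq_zero {L n : ℕ} (c : CechObj y (Thick g L) n) : g ^ L • c = 0 := by
  have h1 : ∀ x : Thick g L, g ^ L • x = 0 := by
    intro x
    obtain ⟨x, rfl⟩ := Ideal.Quotient.mk_surjective x
    rw [Algebra.smul_def, Ideal.Quotient.algebraMap_eq, ← map_mul, Ideal.Quotient.eq_zero_iff_mem]
    exact Ideal.mul_mem_right _ _ (Ideal.mem_span_singleton_self _)
  have h2 : (g ^ L) • (LinearMap.id : Thick g L →ₗ[S] Thick g L) = 0 := by
    apply LinearMap.ext
    intro x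
    rw [LinearMap.smul_apply, LinearMap.id_apply, h1, LinearMap.zero_apply]
  have := cechObjMap_smul_id (y := y) (M := Thick g L) (g ^ L) n
  rw [h2, cechObjMap_zero'] at this
  have h3 := LinearMap.congr_fun this c
  rw [LinearMap.zero_apply, LinearMap.smul_apply, LinearMap.id_apply] at h3
  exact h3.symm

/-- `g` kills the level-`1` cochains. [folklore] -/
theorem smul_cechObj_thick_one_eq_zero {nn : ℕ} (c : CechObj y (Thick g 1) nn) : g • c = 0 := by
  have h1 : ∀ x : Thick g 1, g • x = 0 := by
    intro x
    obtain ⟨x, rfl⟩ := Ideal.Quotient.mk_surjective x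
    rw [Algebra.smul_def, Ideal.Quotient.algebraMap_eq, ← map_mul, Ideal.Quotient.eq_zero_iff_mem]
    refine Ideal.mul_mem_right _ _ ?_
    have : g ∈ Ideal.span ({g ^ 1} : Set S) := by
      rw [pow_one]
      exact Ideal.mem_span_singleton_self g
    exact this
  have h2 : g • (LinearMap.id : Thick g 1 →ₗ[S] Thick g 1) = 0 := by
    apply LinearMap.ext
    intro x
    rw [LinearMap.smul_apply, LinearMap.id_apply, h1, LinearMap.zero_apply]
  have := cechObjMap_smul_id (y := y) (M := Thick g 1) g nn
  rw [h2, cechObjMap_zero'] at this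
  have h3 := LinearMap.congr_fun this c
  rw [LinearMap.zero_apply, LinearMap.smul_apply, LinearMap.id_apply] at h3
  exact h3.symm

/-- `N` is `g`-adically separated: an element divisible by every power of `g` vanishes.
[folklore] -/
theorem Nlim_separated {σ : ∀ L : ℕ, CechObj y (Thick g L) 0}
    (h : ∀ k : ℕ, ∃ τ : ∀ L : ℕ, CechObj y (Thick g L) 0, σ = g ^ k • τ) : σ = 0 := by
  funext L
  obtain ⟨τ, rfl⟩ := h L
  rw [Pi.smul_apply, Pi.zero_apply, pow_smul_cechObj_thick_eq_zero]

/-- A prime not dividing `g` is a non-zero-divisor on every `S/(g^L)` (`S` factorial). [folklore] -/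
theorem isSMulRegular_thick_of_prime_not_dvd [IsDomain S] [UniqueFactorizationMonoid S]
    {p : S} (hp : Prime p) (hpg : ¬ p ∣ g) (L : ℕ) : IsSMulRegular (Thick g L) p := by
  intro a b hab
  obtain ⟨a, rfl⟩ := Ideal.Quotient.mk_surjective a
  obtain ⟨b, rfl⟩ := Ideal.Quotient.mk_surjective b
  simp only [Algebra.smul_def, Ideal.Quotient.algebraMap_eq, ← map_mul] at hab
  rw [Ideal.Quotient.eq] at hab ⊢
  rw [← mul_sub] at hab
  have hg : g ≠ 0 := fun h => hpg (h ▸ dvd_zero p)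
  have hgL : g ^ L ≠ 0 := pow_ne_zero L hg
  have hdvd : g ^ L ∣ (a - b) * p := by
    obtain ⟨c, hc⟩ := Ideal.mem_span_singleton'.mp hab
    exact ⟨c, by rw [mul_comm (a - b), ← hc, mul_comm]⟩
  refine Ideal.mem_span_singleton.mpr
    (UniqueFactorizationMonoid.dvd_of_dvd_mul_left_of_no_prime_factors hgL ?_ hdvd)
  intro d hd hdp hdprime
  have hpd : p ∣ d := hdprime.irreducible.dvd_symm hp.irreducible hdp
  exact hpg (hp.dvd_of_dvd_pow (dvd_trans hpd hd))

/-- A prime element acts injectively on `N`. [folklore] -/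
theorem eq_zero_of_prime_smul_Nlim_eq_zero [IsDomain S] [UniqueFactorizationMonoid S] (hg0 : g ≠ 0)
    {p : S} (hp : Prime p) {σ : ∀ L : ℕ, CechObj y (Thick g L) 0} (hσ : σ ∈ Nlim u n)
    (h : p • σ = 0) : σ = 0 := by
  by_cases hpg : p ∣ g
  · obtain ⟨h', hh'⟩ := hpg
    apply smul_g_injective_Nlim n (mem_nonZeroDivisors_of_ne_zero hg0) hσ
    have e2 : g = h' * p := by rw [mul_comm]; exact hh'
    have e3 : g • σ = (h' * p) • σ := congrArg (fun r : S => r • σ) e2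
    rw [e3, mul_smul, h, smul_zero]
  · funext L
    have hreg := isSMulRegular_cechObj (y := y) (isSMulRegular_thick_of_prime_not_dvd hp hpg L) 0
    refine hreg ?_
    dsimp only
    rw [Pi.zero_apply, smul_zero, ← Pi.smul_apply, h, Pi.zero_apply]

/-- **`N` is torsion-free** over the factorial domain `S`. [folklore] -/
theorem Nlim_torsionFree [IsDomain S] [UniqueFactorizationMonoid S] (hg0 : g ≠ 0)
    {a : S} (ha : a ≠ 0) {σ : ∀ L : ℕ, CechObj y (Thick g L) 0} (hσ : σ ∈ Nlim u n)
    (h : a • σ = 0) : σ = 0 := by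
  induction a using UniqueFactorizationMonoid.induction_on_prime generalizing σ with
  | h₁ => exact absurd rfl ha
  | h₂ x hx =>
    obtain ⟨v, rfl⟩ := hx
    have := congrArg (fun τ => ((v⁻¹ : Sˣ) : S) • τ) h
    simpa [smul_smul] using this
  | h₃ a p ha0 hp ih =>
    have h' : p • (a • σ) = 0 := by rw [← mul_smul, h]
    have haσ : a • σ ∈ Nlim u n := Submodule.smul_mem _ a hσ
    exact ih ha0 hσ (eq_zero_of_prime_smul_Nlim_eq_zero n hg0 hp haσ h')

/-- **One lifting step, scaled**: if `𝔟` kills the obstruction module `E = H²(S/(g), u₁)`, then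
`𝔟 · Γ_L ⊆ im(Γ_{L+1} → Γ_L)`. [folklore] -/
theorem smul_TZ0_le_secIm_succ (hc : IsCompatible u) (hcoc : ∀ L, IsMulCocycle (u L))
    (hg : g ∈ nonZeroDivisors S) (𝔟 : Ideal S) (h𝔟 : ∀ (e : TH2 (u 1)), ∀ r ∈ 𝔟, r • e = 0)
    {L : ℕ} (hL : 1 ≤ L) : 𝔟 • TZ0 (u L) ≤ secIm u L (L + 1) (by omega) := by
  apply Submodule.smul_le.mpr
  intro r hr σ hσ
  rw [mem_secIm_iff]
  have hex : Function.Exact (thickMul g L 1 (L + 1) (by omega))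
      (thickRed g L (L + 1) (by omega)).toLinearMap := exact_thickMul_thickRed g _ _
  have hminj : Function.Injective (thickMul g L 1 (L + 1) (by omega)) :=
    thickMul_injective g hg (by omega)
  have hm : ∀ (a : Thick g (L + 1)) (x : Thick g 1),
      thickMul g L 1 (L + 1) (by omega) (thickRed g 1 (L + 1) (by omega) a * x) =
        a * thickMul g L 1 (L + 1) (by omega) x := fun a x => thickMul_semilinear g _ _ a x
  obtain ⟨e, he⟩ := IsObs.exists (π := thickRed g L (L + 1) (by omega))
    (m := thickMul g L 1 (L + 1) (by omega)) (u := u (L + 1)) (w := u 1)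
    (thickRed g 1 (L + 1) (by omega)) (hc _ _ _) (thickRed_surjective g _) hex hminj hm (hcoc _) σ
    (by rw [hc]; exact hσ)
  have h0 : IsObs (thickRed g L (L + 1) (by omega)) (thickMul g L 1 (L + 1) (by omega)) (u (L + 1))
      (u 1) (r • σ) 0 := by
    have := he.smul r
    rwa [h𝔟 e r hr] at this
  obtain ⟨τ, hτ, hred⟩ := IsObs.exists_lift (thickRed g 1 (L + 1) (by omega)) (hc _ _ _) hm hex h0
  exact ⟨τ, hτ, hred⟩

/-- **`𝔟^k · Γ_L ⊆ im(Γ_{L+k} → Γ_L)`** by iterating the scaled lifting step. [folklore] -/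
theorem pow_smul_TZ0_le_secIm (hc : IsCompatible u) (hcoc : ∀ L, IsMulCocycle (u L))
    (hg : g ∈ nonZeroDivisors S) (𝔟 : Ideal S) (h𝔟 : ∀ (e : TH2 (u 1)), ∀ r ∈ 𝔟, r • e = 0)
    {L : ℕ} (hL : 1 ≤ L) (k : ℕ) : 𝔟 ^ k • TZ0 (u L) ≤ secIm u L (L + k) (by omega) := by
  induction k with
  | zero =>
    intro σ hσ
    rw [pow_zero, Ideal.one_eq_top, Submodule.top_smul] at hσ
    rw [mem_secIm_iff]
    refine ⟨σ, hσ, ?_⟩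
    have hid : thickRed g L (L + 0) (by omega) = AlgHom.id S _ := by
      apply AlgHom.ext
      intro x
      obtain ⟨x, rfl⟩ := Ideal.Quotient.mk_surjective x
      rfl
    rw [hid, AlgHom.toLinearMap_id, cechObjMap_id', LinearMap.id_apply]
  | succ k ih =>
    rw [pow_succ', Submodule.mul_smul]
    refine le_trans (Submodule.smul_mono le_rfl ih) ?_
    apply Submodule.smul_le.mpr
    intro r hr σ hσ
    rw [mem_secIm_iff] at hσ ⊢
    obtain ⟨τ, hτ, rfl⟩ := hσ
    have h1 := smul_TZ0_le_secIm_succ hc hcoc hg 𝔟 h𝔟 (show 1 ≤ L + k by omega)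
      (Submodule.smul_mem_smul hr hτ)
    rw [mem_secIm_iff] at h1
    obtain ⟨τ', hτ', hred⟩ := h1
    refine ⟨τ', hτ', ?_⟩
    rw [← LinearMap.map_smul, ← hred, ← LinearMap.comp_apply, ← cechObjMap_comp]
    congr 2
    apply LinearMap.ext
    intro x
    exact (thickRed_thickRed g (show L ≤ L + k by omega) (show L + k ≤ L + k + 1 by omega) x).symm

/-- **The stable image has finite colength, uniformly**: `𝔟^{n+1} · Γ_1 ⊆ I_1`. [folklore] -/
theorem pow_smul_TZ0_one_le_Istab (hc : IsCompatible u) (hcoc : ∀ L, IsMulCocycle (u L))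
    (hg : g ∈ nonZeroDivisors S) (𝔟 : Ideal S) (h𝔟 : ∀ (e : TH2 (u 1)), ∀ r ∈ 𝔟, r • e = 0) :
    𝔟 ^ (n + 1) • TZ0 (u 1) ≤ Istab u n 1 :=
  pow_smul_TZ0_le_secIm hc hcoc hg 𝔟 h𝔟 le_rfl (n + 1)

end Limit

/-! ## The comparison map `N → J` (sections of the formal bundle to the ideal) -/

section Comparison

variable {S : Type u} [CommRing S] {g : S} {s : ℕ} {y : Fin s → S}
variable (J : Ideal (Thick g 1)) (a : Fin s → Thick g 1) (ha : ∀ i, a i ∈ J)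
variable {u : ∀ L : ℕ, CechObj y (Thick g L) 1} (n : ℕ)
variable (hu : ∀ t : Fin 2 → Fin s,
    u 1 t * LocalizedModule.mk (a (t 0)) 1 = LocalizedModule.mk (a (t 1)) 1)
variable (hJ0 : Function.Injective (cechAug y J))
  (hJ1 : ∀ c : CechObj y J 0, dC 0 c = 0 → ∃ j : J, cechAug y J j = c)

include hu in
/-- Sections map to cocycles of `J` under `Φ₀`. [folklore] -/
theorem dC_twistToIdeal_eq_zero_of_mem_TZ0 {σ : CechObj y (Thick g 1) 0} (hσ : σ ∈ TZ0 (u 1)) :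
    dC 0 (twistToIdeal J a ha 0 σ) = 0 := by
  rw [← twistToIdeal_dT J a ha (u 1) hu 0 σ, LinearMap.mem_ker.mp hσ, map_zero]

include hu hJ1 in
/-- Every element of `N` has a level-`1` value in `J`. [folklore] -/
theorem exists_cechAug_eq_twistToIdeal (hc : IsCompatible u) (x : Nlim u n) :
    ∃ j : J, cechAug y J j = twistToIdeal J a ha 0 ((x : ∀ L, CechObj y (Thick g L) 0) 1) :=
  hJ1 _ (dC_twistToIdeal_eq_zero_of_mem_TZ0 J a ha hu (Istab_le_TZ0 n hc 1 (x.2.1 1)))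

/-- **The comparison map `Ψ : N → J`**: `x ↦` the element of `J` whose Čech `0`-cocycle is
`Φ₀(x₁)` (`J` of depth `≥ 2`). [cite: Grothendieck1968SGA2, Exp. IX §2 / XI 3.13] -/
def compIdeal (hc : IsCompatible u) : Nlim u n →ₗ[S] J where
  toFun x := Classical.choose (exists_cechAug_eq_twistToIdeal J a ha n hu hJ1 hc x)
  map_add' x x' := by
    apply hJ0
    rw [map_add, Classical.choose_spec (exists_cechAug_eq_twistToIdeal J a ha n hu hJ1 hc (x + x')),
      Classical.choose_spec (exists_cechAug_eq_twistToIdeal J a ha n hu hJ1 hc x),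
      Classical.choose_spec (exists_cechAug_eq_twistToIdeal J a ha n hu hJ1 hc x'),
      ← map_add]
    rfl
  map_smul' r x := by
    apply hJ0
    rw [LinearMap.map_smul,
      Classical.choose_spec (exists_cechAug_eq_twistToIdeal J a ha n hu hJ1 hc (r • x)),
      Classical.choose_spec (exists_cechAug_eq_twistToIdeal J a ha n hu hJ1 hc x),
      ← LinearMap.map_smul]
    rfl

/-- The defining property of the comparison map. [folklore] -/
theorem cechAug_compIdeal (hc : IsCompatible u) (x : Nlim u n) :
    cechAug y J (compIdeal J a ha n hu hJ0 hJ1 hc x) =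
      twistToIdeal J a ha 0 ((x : ∀ L, CechObj y (Thick g L) 0) 1) :=
  Classical.choose_spec (exists_cechAug_eq_twistToIdeal J a ha n hu hJ1 hc x)

/-- **Kernel**: `Ψ x = 0` forces `x ∈ gN` (when `Φ₀` is injective). [folklore] -/
theorem exists_eq_smul_of_compIdeal_eq_zero (hc : IsCompatible u) (hg : g ∈ nonZeroDivisors S)
    (hinj : Function.Injective (twistToIdeal (y := y) J a ha 0)) (x : Nlim u n)
    (hx : compIdeal J a ha n hu hJ0 hJ1 hc x = 0) : ∃ x' : Nlim u n, x = g • x' := by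
  have h1 : (x : ∀ L, CechObj y (Thick g L) 0) 1 = 0 := by
    apply hinj
    rw [map_zero, ← cechAug_compIdeal J a ha n hu hJ0 hJ1 hc x, hx, map_zero]
  obtain ⟨τ, hτ, hxτ⟩ := exists_eq_smul_of_apply_one_eq_zero n hc hg x.2 h1
  exact ⟨⟨τ, hτ⟩, Subtype.ext hxτ⟩

/-- **Cokernel**: if `𝔟` kills `E = H²(u₁)`, then for `r ∈ 𝔟^{n+1}` and `j ∈ J` some `x ∈ N` has
`Ψ x = r j`. [folklore] -/
theorem exists_compIdeal_eq_smul (hc : IsCompatible u) (hcoc : ∀ L, IsMulCocycle (u L))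
    (hg : g ∈ nonZeroDivisors S)
    (hstab : ∀ (L c : ℕ), n ≤ c → secIm u L (L + (c + 1)) (by omega) = secIm u L (L + (n + 1)) (by omega))
    (hsurj0 : Function.Surjective (twistToIdeal (y := y) J a ha 0))
    (hinj1 : Function.Injective (twistToIdeal (y := y) J a ha 1))
    (𝔟 : Ideal S) (h𝔟 : ∀ (e : TH2 (u 1)), ∀ r ∈ 𝔟, r • e = 0)
    {r : S} (hr : r ∈ 𝔟 ^ (n + 1)) (j : J) :
    ∃ x : Nlim u n, compIdeal J a ha n hu hJ0 hJ1 hc x = r • j := by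
  obtain ⟨σ, hσ⟩ := hsurj0 (cechAug y J j)
  have hσZ : σ ∈ TZ0 (u 1) := by
    rw [LinearMap.mem_ker]
    apply hinj1
    rw [map_zero, twistToIdeal_dT J a ha (u 1) hu 0 σ, hσ, dC_cechAug]
  have hrσ : r • σ ∈ Istab u n 1 :=
    pow_smul_TZ0_one_le_Istab n hc hcoc hg 𝔟 h𝔟 (Submodule.smul_mem_smul hr hσZ)
  obtain ⟨x, hx, hx1⟩ := exists_mem_Nlim_apply_eq n hc hstab 1 hrσ
  refine ⟨⟨x, hx⟩, hJ0 ?_⟩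
  rw [cechAug_compIdeal, LinearMap.map_smul]
  change twistToIdeal J a ha 0 (x 1) = _
  rw [hx1, LinearMap.map_smul, hσ]

/-- **Separatedness** of `N` (as a subtype). [folklore] -/
theorem Nlim_subtype_separated (x : Nlim u n) (h : ∀ k : ℕ, ∃ x' : Nlim u n, x = g ^ k • x') :
    x = 0 := by
  apply Subtype.ext
  apply Nlim_separated
  intro k
  obtain ⟨x', hx'⟩ := h k
  exact ⟨x', congrArg Subtype.val hx'⟩

/-- **No `𝔪`-torsion modulo `g`**: if `𝔪^k x ⊆ gN` and every `y_i ∈ 𝔪`, then `x ∈ gN`.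
[folklore] -/
theorem exists_eq_smul_of_pow_smul_mem (hc : IsCompatible u) (hg : g ∈ nonZeroDivisors S)
    (𝔪 : Ideal S) (hym : ∀ i, y i ∈ 𝔪) (x : Nlim u n) (k : ℕ)
    (h : ∀ r ∈ 𝔪 ^ k, ∃ x' : Nlim u n, r • x = g • x') : ∃ x' : Nlim u n, x = g • x' := by
  have h1 : (x : ∀ L, CechObj y (Thick g L) 0) 1 = 0 := by
    funext t
    obtain ⟨x', hx'⟩ := h (y (t 0) ^ k) (Ideal.pow_mem_pow (hym _) k)
    have h2 : (y (t 0) ^ k) • ((x : ∀ L, CechObj y (Thick g L) 0) 1) = 0 := by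
      have := congrArg (fun z : Nlim u n => (z : ∀ L, CechObj y (Thick g L) 0) 1) hx'
      simp only [Submodule.coe_smul, Pi.smul_apply] at this
      rw [this]
      exact smul_cechObj_thick_one_eq_zero _
    have hdvd : ∃ K, tupleProd y ![t 0] ∣ tupleProd y t ^ K := by
      refine ⟨1, ?_⟩
      rw [pow_one, show tupleProd y ![t 0] = y (t 0) by simp [tupleProd]]
      exact Finset.dvd_prod_of_mem (fun k => y (t k)) (Finset.mem_univ 0)
    refine smul_injective_cechLoc_of_dvd hdvd ⟨tupleProd y ![t 0] ^ k, k, rfl⟩ ?_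
    have h4 := congrFun h2 t
    rw [Pi.smul_apply, Pi.zero_apply] at h4
    rw [Pi.zero_apply, smul_zero]
    simpa [tupleProd] using h4
  obtain ⟨τ, hτ, hxτ⟩ := exists_eq_smul_of_apply_one_eq_zero n hc hg x.2 h1
  exact ⟨⟨τ, hτ⟩, Subtype.ext hxτ⟩

/-- **Torsion-freeness** of `N` (as a subtype). [folklore] -/
theorem Nlim_subtype_torsionFree [IsDomain S] [UniqueFactorizationMonoid S] (hg0 : g ≠ 0)
    (r : S) (hr : r ≠ 0) (x : Nlim u n) (h : r • x = 0) : x = 0 :=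
  Subtype.ext (Nlim_torsionFree n hg0 hr x.2 (congrArg Subtype.val h))

end Comparison

end Literature.RingTheory.LocalCohomology

end
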